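import Summits.ABC.IUTFork.Joshi.ATS4InitialThetaDataExistenceModelHolds
import Summits.ABC.IUTFork.Joshi.ATS4ReductionBridge
import HarnessLib

/-!
# [J-IV] Theorem 5.7.1, the SECOND conjunct of its conclusion — «… and §4.1.1, §4.1.2, with the prime `ℓ`» — read at
# Mochizuki's `F_mod`-model and PROVED along `thm571Mod_holds` (companion of the T-28 files; closes flag (e))

Record file of the abc-iut cell, block E «type Joshi's construction, test vs S» (rung LADDER-ABC:A2.E; seat abc-iut-E-t28, slot
T-28, registry row J4:Thm5.7.1; authors-first companion under the END-GAME BOOK of `HOME/plan/E/ASSIGNMENTS.md` §2d). SOURCE (own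
reading of the cell's render `HOME/lit/renders/Joshi-arxiv-2403.10430/pNNNN.txt`; «p.N l.M» = line M of page file N): K. Joshi,
*Construction of Arithmetic Teichmüller Spaces IV: Proof of the abc-conjecture*, arXiv:2403.10430v2 («Preliminary version for
comments», UNREFEREED) = [J-IV]: Thm. 5.7.1 p.53 l.31–45; §4.1.1 p.37 l.29–p.38 l.3; §4.1.2 p.38 l.4–10; Prop. 4.1.1 p.38 l.12–24.
TAKES NO SIDE on [IUTchIII] Cor. 3.12, on the claims of K. Joshi, or on S. Mochizuki's reports on them; typed ≠ proved; typed AS A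
CANDIDATE ≠ endorsed; NO abc claim. CLASSICAL throughout (no Θ-link, no [IUTchIV] Theorem 1.10, nothing of [IUTchIII]).

## What this file adds

The printed conclusion of Thm. 5.7.1 (p.53 l.44–45) is a CONJUNCTION: «`C_λ` satisfies Initial-Theta Data [Joshi, 2024c, § 3.1, § 3.3]
(also [Mochizuki, 2021a, § 3.1]) **and § 4.1.1, § 4.1.2, with the prime `ℓ`**». The statement file `ATS4InitialThetaDataExistence.lean`
(p430905) types the first conjunct (`HasInitialThetaData`; at the `F_mod`-model `HasInitialThetaDataMod`, p433410, PROVED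
unconditionally in `thm571Mod_holds`, p433999) and carries the second only as the docstring flag (e): «(6) `ℓ ≥ 5` is
`ATS3.InitialThetaData.five_le`, (7) (9) are `Cor22.IsThetaField`, (2)–(5) notation, (1) (4) (8) consequences — not separately typed here
(merge-debt T-26)». Slot T-26 (E-t26, `ATS4Differents.lean` p430056) has since typed §4.1.1 (1) and §4.1.2 (6) as the `Prop`s
`ReductionDatum.GoodReductionHyp` / `ReductionDatum.EllHyp` over an abstract reduction signature, PROVED that §4.1.1 (4)–(5) hold for every
number field (`eMod_le_dMod`, `eStarMod_le_dStarMod`), and E-t6 (`ATS4ReductionBridge.lean` p432257) has instantiated the signature by a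
genuine curve (`ReductionDatum.ofCurve C ℓ`). This file therefore types OUR READING of the second conjunct AT THE `F_mod`-MODEL of
[IUTchIV] Cor. 2.2 (ii) (the object `thm571Mod_holds` speaks about: `L := FTheta λ = F_mod(√−1, W[2·3·5])`, `W = modCurve λ` the
`F_mod = ℚ(j_λ)`-model, `C := ETheta λ = W ⊗ L`, `L_tpd := F_tpd = ℚ(λ)`):

* §4.1.1 (1) «`C/L` has good reduction at `v ∈ V^good_L ∩ V^non_L ∩ {v ∤ 2·ℓ}`» = `(ReductionDatum.ofCurve (ETheta λ) ℓ).GoodReductionHyp`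
  — PROVED for every `λ` and every `ℓ` (`goodReductionHyp_model`): `E_F` is SEMISTABLE (its `15`-torsion is `F`-rational; the tree's
  `modelCurve_isSemistable`, [IUTchIV] Prop. 1.8 (v)), and a semistable place of residue characteristic `∤ 2ℓ` that is not an odd
  multiplicative place is a place of good reduction. (Hence Prop. 4.1.1 (3), which IS (1): `prop411_3_model`.)
* §4.1.1 (2)–(5): notation + the automatic (4)–(5) — E-t26's `dMod`, `dStarMod` (= this slot's `deltaMod`, `deltaMod_eq`), `eMod_le_dMod`,
  `eStarMod_le_dStarMod`, cited BY NAME (`constants_model`).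
* §4.1.2 (6) «`ℓ ≥ 5` is a prime» = `(ReductionDatum.ofCurve (ETheta λ) ℓ).EllHyp` — from `ℓ` prime and `ℓ ≥ 7` (`ITDConditions`).
* §4.1.2 (7) «`C_L(L) ⊃ C_L[15](L̄)`» = `Torsion15RationalMod λ`: every `L̄`-point of `C` killed by `15` is `L`-rational — PROVED
  (`torsion15RationalMod_holds`, from the tree's `torsion_thirty_rational`: the whole `30`-torsion is `F`-rational).
* §4.1.2 (8) «`L_mod ⊆ L_tpd = L_mod(C_{L_mod}[2](L̄)) ⊆ L`» = `TowerMod λ`: `F_mod = ℚ(j_λ) ⊆ F_tpd = ℚ(λ) = F_mod(λ)` (the Legendre parameter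
  `λ` IS the `2`-torsion datum `{0, 1, λ}` of print's `C_λ : y² = x(x−1)(x−λ)`), and `F_tpd ↪ L` over `F_mod` — PROVED for minimally presented
  `λ ∈ U` (`towerMod_of_mem_UP`, the tree's `adjoin_fMod_x_eq_top`, `nonempty_algHom_tpd`).
* §4.1.2 (9) «`L = L_tpd(√−1, C_{L_tpd}[3·5])`, this implies that `C_L` is extended from `C_{L_tpd}`» = `FieldShapeMod λ`: `√−1 ∈ L` and `L =
  F_mod(√−1)·F_mod(W[2])·F_mod(W[3])·F_mod(W[5])` (the FIRST printed form of [IUTchIV] Thm. 1.10 p.22 «`F = F_mod(√−1, E_{F_mod}[2·3·5]) :=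
  F_tpd(√−1, E_{F_tpd}[3·5])`») — TRUE BY CONSTRUCTION of the tree's `thetaDataField` (`fieldShapeMod_holds`: `exists_sq_eq_neg_one` + `rfl`),
  `C = W ⊗ L` being extended from `W ⊗ F_tpd` by definition. READING FLAG (e′): the second printed form adjoins to `L_tpd` only `√−1` and the
  `15`-torsion; it agrees with the first iff `F_mod(W[2]) ⊆ F_tpd(√−1)` inside `L`, which holds (the `2`-torsion abscissae generate `F_mod(λ)`,
  except at `j = 1728` where Mathlib's `ofJ` model `y² = x³ + x` has `2`-torsion field `F_mod(√−1)`) but is NOT proved here.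

Composition: `hyp411412Mod_of_conditions` ((1)(6)(7)(8)(9) from `λ ∈ U_P`, `ℓ` prime, `ITDConditions λ ℓ`) and **`thm571Mod412_holds :
Thm571With lem587Window HasInitialThetaData412Mod`** — [J-IV] Thm. 5.7.1 with the `ℓ`-window of its own proof (Lem. 5.8.7 (1), Joshi's `δ =
d*_mod`) and its WHOLE printed conclusion «Initial Theta Data AND §4.1.1, §4.1.2 with the prime `ℓ`» read at the `F_mod`-model, UNCONDITIONALLY
(`thm571Conditions_holds` p432027 + `hasInitialThetaDataMod_of_conditions` p433410 + this file). What still separates this from the AS-PRINTED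
`Thm571` is unchanged and on record: flag (a) (printed window «`log(2·δ·log Q)`») and flag (f)/N1 (Legendre curve over an arbitrary theta field
vs the `F_mod`-model), plus (e′) above.

READING NOTE (E-t26's row J4:Prop4.1.1, recorded, NOT a test row): Prop. 4.1.1 (1) «semistable [= bad multiplicative] iff `v ∈ V^{odd,ss}`» and
(2) «good or additive reduction if `v | 2ℓ`» are NOT consequences of the hypotheses at the model — `E_F` is semistable at EVERY place, so at a
place over `2` with `|j_λ|_2 > 1` (allowed by (5.6.2), which only BOUNDS `|j|_2` on `Z_2`) it has bad MULTIPLICATIVE reduction; [IUTchIV]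
Cor. 2.2 controls the places over `2` through (∗^{j-inv}), not by excluding bad reduction there. Only (3) is proved here.

[claim: Joshi2024ATS4, status: disputed] (unrefereed preprint); [claim: Mochizuki2012, status: disputed] for the [IUTchIV] decls cited BY NAME.
DEFS-FREEZE respected (imports BY NAME; no `Cor312*` / `Thm311*` import, E-PLAN R14). No new `Prop` fact; standard axioms only.
-/

noncomputable section

open scoped Classical
open NumberField IsDedekindDomain
open Literature.NumberTheory.DiophantineGeometry.GenEll Literature.IUT.LogVolume
open Literature.IUT.HodgeTheaters hiding InitialThetaData residueChar

namespace Summit.ABC.IUTFork.Joshi.ATS4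

/-! ## §4.1.1 (1) at the `F_mod`-model: good reduction off `V^{odd,ss} ∪ {v | 2ℓ}` — PROVED from semistability -/
section GoodReduction

variable (P : NFPoint) (ℓ : ℕ)

/-- **[J-IV] §4.1.1 (1), p.37 l.33–35** «`C/L` has good reduction at `v ∈ V^good_L ∩ V^non_L ∩ {v ∈ V_L : v` does not divide `(2·ℓ)}`» HOLDS
for `C = E_F = W ⊗ F` over `L = F = F_mod(√−1, W[2·3·5])` (the `F_mod`-model of the point `λ`, the tree's `ETheta λ` / `FTheta λ`) and EVERY
`ℓ`, in E-t26's typing `ReductionDatum.GoodReductionHyp` read through E-t6's `ReductionDatum.ofCurve`: `E_F` is semistable at every finite place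
(`modelCurve_isSemistable`: the `15`-torsion is `F`-rational, [IUTchIV] Prop. 1.8 (v)), a place not dividing `2ℓ` has odd residue
characteristic, so a semistable place outside `V^{odd,ss}` (odd + multiplicative) is good. PROVED. [claim: Joshi2024ATS4, status: disputed] -/
theorem goodReductionHyp_model : (ReductionDatum.ofCurve (ETheta P) ℓ).GoodReductionHyp := by
  rw [ReductionDatum.goodReductionHyp_ofCurve_iff]
  intro v hnot hndvd
  rcases modelCurve_isSemistable (modCurve P) v with hg | hm
  · exact hg
  · exfalso
    refine hnot ⟨?_, hm⟩
    rcases (residueChar_prime (FTheta P) v).eq_two_or_odd' with h2 | hodd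
    · exact absurd (h2 ▸ dvd_mul_right 2 ℓ) hndvd
    · exact hodd

/-- **[J-IV] Prop. 4.1.1 (3), p.38 l.18–22** «`C/L` has good reduction at `v ∉ V^{odd,ss} ∪ {w ∈ V_L : w | (2ℓ)}`» at the `F_mod`-model — it IS
§4.1.1 (1) (E-t26's `prop411_3_iff_goodReductionHyp`). PROVED. (Parts (1)–(2) of Prop. 4.1.1 are NOT derived: see the module docstring's
READING NOTE — `E_F` may be multiplicative above `2`.) [claim: Joshi2024ATS4, status: disputed] -/
theorem prop411_3_model : (ReductionDatum.ofCurve (ETheta P) ℓ).Prop411_3 :=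
  (ReductionDatum.prop411_3_iff_goodReductionHyp _).2 (goodReductionHyp_model P ℓ)

/-- **[J-IV] §4.1.1 (2)–(5) at the `F_mod`-model** (p.37 l.36–p.38 l.3): with `L_mod := F_mod = ℚ(j_λ)` (the tree's `FMod λ`), E-t26's
constants satisfy `d*_mod = 2¹²·3³·5·d_mod` (= this slot's `δ(λ)`, `deltaMod`), the printed ASSUMPTION (4) «`e_mod ≤ d_mod`» and (5)
«`e*_mod ≤ d*_mod`» — both automatic (`eMod_le_dMod`, `eStarMod_le_dStarMod`, slot T-26). PROVED (citation BY NAME). [claim: Joshi2024ATS4,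
status: disputed] -/
theorem constants_model :
    deltaMod P = (dStarMod (FMod P) : ℝ) ∧ eMod (FMod P) ≤ dMod (FMod P) ∧ eStarMod (FMod P) ≤ dStarMod (FMod P) :=
  ⟨rfl, eMod_le_dMod, eStarMod_le_dStarMod⟩

end GoodReduction

/-! ## §4.1.2 (7), (8), (9) at the `F_mod`-model -/
section Tower

variable (P : NFPoint)

/-- **[J-IV] §4.1.2 (7), p.38 l.8: «`C_L(L) ⊃ C_L[15](L)`»** (the `15`-torsion of `C` is `L`-rational), READ at the `F_mod`-model `C = E_F =
ETheta λ` over `L = F = FTheta λ` with `L̄ = AlgebraicClosure F`: every `L̄`-point of `C` killed by `15` is the base change of an `L`-point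
(same phrasing as E-t6's `ATS3.InitialThetaData.torsion_six_rational`, [J-III] §3.3 (10)). A READING predicate; proved below.
[claim: Joshi2024ATS4, status: disputed] -/
def Torsion15RationalMod : Prop :=
  ∀ Q : GeomPoints (AlgebraicClosure (FTheta P)) (ETheta P), (15 : ℤ) • Q = 0 →
    Q ∈ Set.range (WeierstrassCurve.Affine.Point.baseChange (W' := (ETheta P).toAffine)
      (FTheta P) (AlgebraicClosure (FTheta P)))

/-- §4.1.2 (7) HOLDS at the `F_mod`-model: the whole `30`-torsion of `E_F` is `F`-rational (the tree's `torsion_thirty_rational`, [IUTchIV]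
Thm. 1.10 p.22 / [IUTchI] Def. 3.1 (b)), and `15·Q = 0 ⇒ 30·Q = 0`. PROVED. [claim: Joshi2024ATS4, status: disputed] -/
theorem torsion15RationalMod_holds : Torsion15RationalMod P := fun Q hQ =>
  torsion_thirty_rational (modCurve P) Q (by
    rw [show (30 : ℤ) = 2 * 15 by norm_num, mul_smul, hQ, smul_zero])

/-- **[J-IV] §4.1.2 (8), p.38 l.9: «`L_mod ⊆ L_tpd = L_mod(C_{L_mod}[2](L)) ⊆ L`»**, READ at the `F_mod`-model with print's own `L_mod = ℚ(j_λ)`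
(Thm. 5.7.1 p.53 l.39–40, `FMod λ ⊆ ℚ(λ)`) and `L_tpd := F_tpd = ℚ(λ)` ([IUTchIV] Cor. 2.2 (ii) p.42 «`F_tpd := F_mod(E_{F_mod}[2])`»; for
print's Legendre curve `C_λ : y² = x(x−1)(x−λ)` the `2`-torsion is `{(0,0), (1,0), (λ,0)}`, so `L_mod(C_λ[2]) = L_mod(λ)`): `F_tpd = F_mod(λ)`
and `F_tpd` embeds into `L = FTheta λ` over `F_mod` (`L_tpd ⊆ L`). A READING predicate; proved below for minimally presented `λ ∈ U`.
[claim: Joshi2024ATS4, status: disputed] -/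
def TowerMod : Prop :=
  IntermediateField.adjoin (FMod P) ({P.x} : Set P.F) = ⊤ ∧ Nonempty (P.F →ₐ[FMod P] FTheta P)

/-- §4.1.2 (8) HOLDS at the `F_mod`-model for `λ ∈ U` minimally presented (`λ ∈ U_P`: `ℚ(λ) = F_tpd`): `F_tpd = F_mod(λ)` is the tree's
`adjoin_fMod_x_eq_top`, the embedding `F_tpd ↪ F` over `F_mod` is the tree's `nonempty_algHom_tpd` / `tpdEmb` (`λ ↦` a Legendre parameter of
`E_F`, which exists because `W[2] ⊆ W[30]` is `F`-rational). PROVED. [claim: Joshi2024ATS4, status: disputed] -/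
theorem towerMod_of_mem_UP {P : NFPoint} (hP : P ∈ UP) : TowerMod P :=
  ⟨adjoin_fMod_x_eq_top P hP.2, nonempty_algHom_tpd P hP⟩

/-- **[J-IV] §4.1.2 (9), p.38 l.10: «`L = L_tpd(√−1, C_{L_tpd}[3·5])` this implies that `C_L` is extended from `C_{L_tpd}`»**, READ at the
`F_mod`-model in the FIRST printed form of [IUTchIV] Thm. 1.10 p.22 («`F = F_mod(√−1, E_{F_mod}[2·3·5]) := F_tpd(√−1, E_{F_tpd}[3·5])`»): `√−1 ∈ L`
and `L` is the compositum `F_mod(√−1)·F_mod(W[2])·F_mod(W[3])·F_mod(W[5])` inside `F̄_mod` (the tree's division fields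
`WeierstrassCurve.divisionField`); `C = W ⊗ L` is extended from `W ⊗ L_tpd` by definition. READING FLAG (e′): identifying this with the second
printed form needs `F_mod(W[2]) ⊆ L_tpd(√−1)`, true but not proved here (module docstring). [claim: Joshi2024ATS4, status: disputed] -/
def FieldShapeMod : Prop :=
  (∃ i : FTheta P, i ^ 2 = -1) ∧
    thetaDataField (modCurve P) =
      IntermediateField.adjoin (FMod P) {sqrtNegOne (FMod P)} ⊔ (modCurve P).divisionField 2 ⊔
        (modCurve P).divisionField 3 ⊔ (modCurve P).divisionField 5

/-- §4.1.2 (9) HOLDS at the `F_mod`-model — BY CONSTRUCTION of the tree's `thetaDataField` (`exists_sq_eq_neg_one`; the compositum equation is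
definitional). PROVED. [claim: Joshi2024ATS4, status: disputed] -/
theorem fieldShapeMod_holds : FieldShapeMod P :=
  ⟨exists_sq_eq_neg_one (modCurve P), rfl⟩

end Tower

/-! ## The second conjunct of Thm. 5.7.1's conclusion, and the whole conclusion, at the `F_mod`-model -/
section Conclusion

/-- **OUR READING of «[`C_λ` satisfies] § 4.1.1, § 4.1.2, with the prime `ℓ`» (Thm. 5.7.1, p.53 l.44–45) at the `F_mod`-model**: §4.1.1 (1)
(`GoodReductionHyp` of `ReductionDatum.ofCurve (ETheta λ) ℓ`), §4.1.2 (6) (`EllHyp`: `ℓ` prime, `ℓ ≥ 5`), (7) `Torsion15RationalMod`, (8)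
`TowerMod`, (9) `FieldShapeMod`; §4.1.1 (2)–(5) are notation / automatic (`constants_model`). A READING predicate (flag (e) of the statement
file made explicit); NOT asserted in print as a separate statement. [claim: Joshi2024ATS4, status: disputed] -/
def Hyp411412Mod (P : NFPoint) (ℓ : ℕ) : Prop :=
  (ReductionDatum.ofCurve (ETheta P) ℓ).GoodReductionHyp ∧ (ReductionDatum.ofCurve (ETheta P) ℓ).EllHyp ∧
    Torsion15RationalMod P ∧ TowerMod P ∧ FieldShapeMod P

/-- **§4.1.1 (1) + §4.1.2 (6)–(9) HOLD at the `F_mod`-model** for `λ ∈ U_P` and any prime `ℓ ≥ 5` ((1), (7), (9) hold for every `λ` and `ℓ`;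
(8) uses the minimal presentation; (6) is the hypothesis on `ℓ`). PROVED. [claim: Joshi2024ATS4, status: disputed] -/
theorem hyp411412Mod_of_mem_UP {P : NFPoint} (hP : P ∈ UP) {ℓ : ℕ} (hℓ : ℓ.Prime) (h5 : 5 ≤ ℓ) : Hyp411412Mod P ℓ :=
  ⟨goodReductionHyp_model P ℓ, ⟨hℓ, h5⟩, torsion15RationalMod_holds P, towerMod_of_mem_UP hP, fieldShapeMod_holds P⟩

/-- The same from the proof-level reading `ITDConditions λ ℓ` («Completion of the Proof», p.57 l.17–26; `ℓ ≥ 7`). PROVED.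
[claim: Joshi2024ATS4, status: disputed] -/
theorem hyp411412Mod_of_conditions {P : NFPoint} (hP : P ∈ UP) {ℓ : ℕ} (hℓ : ℓ.Prime) (h : ITDConditions P ℓ) :
    Hyp411412Mod P ℓ :=
  hyp411412Mod_of_mem_UP hP hℓ (le_trans (by norm_num) h.1)

/-- **OUR READING of the WHOLE printed conclusion of Thm. 5.7.1 at the `F_mod`-model**, «`C_λ` satisfies Initial-Theta Data [Joshi, 2024c, § 3.1, §
3.3] (also [Mochizuki, 2021a, § 3.1]) and § 4.1.1, § 4.1.2, with the prime `ℓ`» (p.53 l.44–45): `HasInitialThetaDataMod λ ℓ` (p433410: Joshi's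
[J-III] §3.1 + §3.3 structure INHABITED at `(F_mod(√−1, W[30]), F(E_F[ℓ]), F̄, W ⊗ F, ℓ)`) AND `Hyp411412Mod λ ℓ`. [claim: Joshi2024ATS4, status:
disputed] -/
def HasInitialThetaData412Mod (P : NFPoint) (ℓ : ℕ) : Prop := HasInitialThetaDataMod P ℓ ∧ Hyp411412Mod P ℓ

/-- **Transfer**: for every `ℓ`-window `W`, Thm. 5.7.1 with the arithmetic conclusion `ITDConditions ∧ AdmitsCore` implies Thm. 5.7.1 with the
WHOLE printed conclusion read at the `F_mod`-model (same `Exc`, same `ℓ`; points of `Z ∩ U(Q̄)_{≤d}` lie in `U_P`). PROVED. [claim: Joshi2024ATS4,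
status: disputed] -/
theorem thm571Mod412_of_conditions {W : NFPoint → ℕ → Prop}
    (h : Thm571With W (fun P ℓ => ITDConditions P ℓ ∧ Cor22.AdmitsCore P)) : Thm571With W HasInitialThetaData412Mod := by
  intro Z h2 h562 d hd
  obtain ⟨Exc, hfin, hsub, hmain⟩ := h Z h2 h562 d hd
  refine ⟨Exc, hfin, hsub, fun P hP hPexc => ?_⟩
  obtain ⟨ℓ, hℓ, hW, hI, hcore⟩ := hmain P hP hPexc
  exact ⟨ℓ, hℓ, hW, hasInitialThetaDataMod_of_conditions hP.2.1 hℓ hI hcore, hyp411412Mod_of_conditions hP.2.1 hℓ hI⟩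

/-- **[J-IV] Theorem 5.7.1 (Lem-5.8.7 window, Joshi's `δ`; conclusion = «Initial Theta Data [J-III §3.1, §3.3] AND §4.1.1, §4.1.2 with the prime
`ℓ`» read at the `F_mod`-model) HOLDS** — PROVED, unconditionally, classically: for every compactly bounded `Z ⊆ U(Q̄)` with `2 ∈ S` and
(5.6.2) and every `d ≥ 1` there is a finite `Exc ⊆ U(Q̄)_{≤d}` off which every `x_λ ∈ Z ∩ U(Q̄)_{≤d}` admits a prime `ℓ` with `Q^{1/2} ≤ ℓ ≤
10·δ·Q^{1/2}·log(2·δ·Q)` such that Joshi's Initial Theta Data EXIST at `(F_mod(√−1, W[30]), F(E_F[ℓ]), F̄, W ⊗ F, ℓ)` AND §4.1.1 (1), §4.1.2 (6)–(9)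
hold there (`thm571Conditions_holds` p432027 composed with `thm571Mod412_of_conditions`). Flags (a), (f)/N1, (e′) separate this from the
AS-PRINTED `Thm571` (module docstring). [claim: Joshi2024ATS4, status: disputed] -/
theorem thm571Mod412_holds : Thm571With lem587Window HasInitialThetaData412Mod :=
  thm571Mod412_of_conditions thm571Conditions_holds

/-- The model-reading theorem of record `thm571Mod_holds` (p433999) is the first projection of `thm571Mod412_holds` (consistency check;
`thm571With_mono`). PROVED. [claim: Joshi2024ATS4, status: disputed] -/
theorem thm571Mod_of_thm571Mod412 (h : Thm571With lem587Window HasInitialThetaData412Mod) :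
    Thm571With lem587Window HasInitialThetaDataMod :=
  thm571With_mono (fun _ _ _ hW => hW) (fun _ _ _ _ hI => hI.1) h

end Conclusion

end Summit.ABC.IUTFork.Joshi.ATS4

end
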